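import Summits.Langlands.Langlands.Theses.DisagreementBeurling

/-!
# Line `layer_induction_descent` for the crux `CanonicalDescent36` (stmt-Langlands-13935)

Skeleton of the canonical proof (Lapid 1998 Rem. 3; the route's TWO-LAYER PLAN): three registered
stubs — the quadratic LAYER of the Hessian group `3²:4` (group theory + Galois bookkeeping),
MONOMIAL automorphic INDUCTION in rank 3 over the layer (JPSS 1981 + Arthur–Clozel III.6), and the
PINNED quadratic DESCENT back to `F` (Arthur–Clozel III.4.2 (d) + SMO + CFT, `n = 3` odd) — and the
kernel-checked composition `CanonicalDescent36_of` concluding the route decl BY NAME (no hypotheses;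
it consumes the three `stub_*` by name through `canonicalDescent36_of_statements`).
The three stub statements are verbatim the split children `HessianQuadraticLayer`,
`MonomialStrongArtin3`, `PinnedQuadraticDescent3` (planner children.json / SPLIT.md workfile), named
below as `def`s for the statement-level composition. Sorries ONLY inside `stub_*`.
-/

open scoped BigOperators Topology Manifold Classical MeasureTheory ProbabilityTheory Matrix InnerProductSpace ComplexConjugate ContinuousMap
open Filter Set Function TopologicalSpace MeasureTheory

set_option linter.dupNamespace false

namespace Summit.Langlands.Langlands.Cruxes.CanonicalDescent36.LayerInductionDescent

/-- The crux under attack, by name (abbrev, so that only `CanonicalDescent36_of` is read as THE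
composition by the skeleton audit). -/
abbrev Crux : Prop :=
  Summit.Langlands.Langlands.Theses.DisagreementBeurling.CanonicalDescent36

/-! ## The three piece statements (= the split children, verbatim) -/

/-- X₁ — the quadratic layer of a `3²:4`-type `ρ` (group theory + Galois bookkeeping). -/
def HessianQuadraticLayer : Prop :=
  ∀ (F : Type) [Field F] [NumberField F] (ρ : Literature.NumberTheory.GaloisRepresentations.FramedGaloisRep F ℂ 3), ρ.toGaloisRep.IsIrreducible → (Nat.card (Matrix.ProjGenLinGroup.mk.comp ρ.toMonoidHom).range = 36 ∧ Subgroup.center (Matrix.ProjGenLinGroup.mk.comp ρ.toMonoidHom).range = ⊥ ∧ ∃ g : (Matrix.ProjGenLinGroup.mk.comp ρ.toMonoidHom).range, orderOf g = 4) → ∃ (M : Type) (_ : Field M) (_ : NumberField M) (_ : Algebra F M), Module.finrank F M = 2 ∧ (ρ.restrictField M).toGaloisRep.IsIrreducible ∧ (∃ g : GL (Fin 3) ℂ, ∀ (σ : Field.absoluteGaloisGroup M) (i : Fin 3), ∃! j : Fin 3, ((Literature.NumberTheory.GaloisRepresentations.FramedRep.conj g (ρ.restrictField M) σ : GL (Fin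 3) ℂ) : Matrix (Fin 3) (Fin 3) ℂ) i j ≠ 0) ∧ ∀ᶠ v : IsDedekindDomain.HeightOneSpectrum (NumberField.RingOfIntegers F) in Filter.cofinite, ∀ β : Multiset ℂ, ρ.HasFrobCharpolyAt v (Literature.NumberTheory.Automorphic.satakePolynomial β) → (β.map (· ^ 2)).toFinset.card ≠ 2 → ∃ w : IsDedekindDomain.HeightOneSpectrum (NumberField.RingOfIntegers M), w.asIdeal.under (NumberField.RingOfIntegers F) = v.asIdeal ∧ w.asIdeal.inertiaDeg (NumberField.RingOfIntegers F) = 1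

/-- X₂ — strong Artin (a.e. form, Artin infinity type) for irreducible MONOMIAL rank-3 Artin
representations over any number field (JPSS 1981 + Arthur–Clozel III.6). -/
def MonomialStrongArtin3 : Prop :=
  ∀ (M : Type) [Field M] [NumberField M] (ρ : Literature.NumberTheory.GaloisRepresentations.FramedGaloisRep M ℂ 3), ρ.toGaloisRep.IsIrreducible → (∃ g : GL (Fin 3) ℂ, ∀ (σ : Field.absoluteGaloisGroup M) (i : Fin 3), ∃! j : Fin 3, ((Literature.NumberTheory.GaloisRepresentations.FramedRep.conj g ρ σ : GL (Fin 3) ℂ) : Matrix (Fin 3) (Fin 3) ℂ) i j ≠ 0) → ∃ (hcpt : Literature.NumberTheory.Automorphic.isCompact_glFiniteIntegralLevel 3 M) (P : Literature.NumberTheory.Automorphic.CuspidalAutomorphicRepData 3 M hcpt), P.1.HasInfinityType (fun _ => Multiset.replicate 3 ({ a := 0, b := 0, exists_int_sub := ⟨0, (sub_zero (0 : ℂ)).trans Int.cast_zero.symm⟩ } : Literature.NumberTheory.Automorphic.ArchWeight)) ∧ ∀ᶠ w : IsDedekindDomain.HeightOneSpectrum (NumberField.RingOfIntegers M) in Filter.cofinite,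 ∃ γ : Multiset ℂ, P.1.HasSatakeParamAt w γ ∧ ρ.IsUnramifiedAt w ∧ ρ.HasFrobCharpolyAt w (Literature.NumberTheory.Automorphic.satakePolynomial γ)

/-- X₃ — Arthur–Clozel III.4.2 (d) quadratic descent of the a.e. matching, pinned by `det`
(`n = 3` odd), with the split/inert Satake pattern. -/
def PinnedQuadraticDescent3 : Prop :=
  ∀ (F : Type) [Field F] [NumberField F] (M : Type) [Field M] [NumberField M] [Algebra F M], Module.finrank F M = 2 → ∀ (ρ : Literature.NumberTheory.GaloisRepresentations.FramedGaloisRep F ℂ 3) (hcptM : Literature.NumberTheory.Automorphic.isCompact_glFiniteIntegralLevel 3 M) (PM : Literature.NumberTheory.Automorphic.CuspidalAutomorphicRepData 3 M hcptM), PM.1.HasInfinityType (fun _ => Multiset.replicate 3 ({ a := 0, b := 0, exists_int_sub := ⟨0, (sub_zero (0 : ℂ)).trans Int.cast_zero.symm⟩ } : Literature.NumberTheory.Automorphic.ArchWeight)) → (∀ᶠ w : IsDedekindDomain.HeightOneSpectrum (NumberField.RingOfIntegers M) in Filter.cofinite, ∃ γ : Multiset ℂ, PM.1.HasSatakeParamAt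 w γ ∧ (ρ.restrictField M).IsUnramifiedAt w ∧ (ρ.restrictField M).HasFrobCharpolyAt w (Literature.NumberTheory.Automorphic.satakePolynomial γ)) → ∃ (hcpt : Literature.NumberTheory.Automorphic.isCompact_glFiniteIntegralLevel 3 F) (P : Literature.NumberTheory.Automorphic.CuspidalAutomorphicRepData 3 F hcpt), P.1.HasInfinityType (fun _ => Multiset.replicate 3 ({ a := 0, b := 0, exists_int_sub := ⟨0, (sub_zero (0 : ℂ)).trans Int.cast_zero.symm⟩ } : Literature.NumberTheory.Automorphic.ArchWeight)) ∧ ∀ᶠ v : IsDedekindDomain.HeightOneSpectrum (NumberField.RingOfIntegers F) in Filter.cofinite, ∃ α β : Multiset ℂ, P.1.HasSatakeParamAt v α ∧ ρ.IsUnramifiedAt v ∧ ρ.HasFrobCharpolyAt v (Literature.NumberTheory.Automorphic.satakePolynomial β) ∧ (∀ x ∈ β, ‖x‖ = 1) ∧ (∀ a ∈ α, ‖a‖ = 1) ∧ α.map (· ^ 2) = β.map (· ^ 2) ∧ α.prod = β.prod ∧ ((∃ w : IsDedekindDomain.HeightOneSpectrum (NumberField.RingOfIntegers M), w.asIdeal.under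 (NumberField.RingOfIntegers F) = v.asIdeal ∧ w.asIdeal.inertiaDeg (NumberField.RingOfIntegers F) = 1) → α = β)

/-! ## Statement-level composition (sorry-free) -/

/-- `X₁ → X₂ → X₃ → CanonicalDescent36`: 14 tactic lines (layer, induction over the layer, descent,
merge of two cofinite filters with the order-4 case split). -/
theorem canonicalDescent36_of_statements :
    HessianQuadraticLayer → MonomialStrongArtin3 → PinnedQuadraticDescent3 → Crux := by
  intro h₁ h₂ h₃ F _ _ ρ hirr htype
  -- (1) the quadratic layer `M/F` cut out by the index-two subgroup `3²:2 ≤ 3²:4`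
  obtain ⟨M, _, _, _, hdeg, hirrM, hmono, hdict⟩ := h₁ F ρ hirr htype
  -- (2) automorphic induction over `M`: `ρ|_M` is irreducible and monomial
  obtain ⟨hcptM, PM, hinfM, hmatchM⟩ := h₂ M (ρ.restrictField M) hirrM hmono
  -- (3) pinned quadratic descent `M ↝ F`
  obtain ⟨hcpt, P, hinf, hpat⟩ := h₃ F M hdeg ρ hcptM PM hinfM hmatchM
  refine ⟨hcpt, P, hinf, ?_⟩
  -- (4) the a.e. pattern: merge the descent pattern with the Frobenius dictionary of the layer
  filter_upwards [hpat, hdict] with v hv hd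
  obtain ⟨α, β, hα, hur, hβ, huβ, huα, hsq, hprod, hsplit⟩ := hv
  refine ⟨α, β, hα, hur, hβ, huβ, huα, ?_, ?_⟩
  · -- not exactly two distinct squares ⇒ a degree-one prime of `M` over `v` ⇒ exact matching
    intro hne
    exact hsplit (hd β hβ hne)
  · -- exactly two distinct squares (inert places): squares and determinant only
    intro _
    exact ⟨hsq, hprod⟩

/-! ## Registered stubs -/

/-- STUB 1 (X₁ = `HessianQuadraticLayer`): the quadratic layer `M/F` of a `3²:4`-type `ρ`, with
`ρ|_{Γ_M}` irreducible and monomial, and the Frobenius dictionary "not exactly two distinct squares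
⇒ a degree-one prime of `M` over `v`". Group theory of `3²:4 ⊂ PGL₃(ℂ)`; size M. -/
theorem stub_hessianQuadraticLayer :
    ∀ (F : Type) [Field F] [NumberField F] (ρ : Literature.NumberTheory.GaloisRepresentations.FramedGaloisRep F ℂ 3), ρ.toGaloisRep.IsIrreducible → (Nat.card (Matrix.ProjGenLinGroup.mk.comp ρ.toMonoidHom).range = 36 ∧ Subgroup.center (Matrix.ProjGenLinGroup.mk.comp ρ.toMonoidHom).range = ⊥ ∧ ∃ g : (Matrix.ProjGenLinGroup.mk.comp ρ.toMonoidHom).range, orderOf g = 4) → ∃ (M : Type) (_ : Field M) (_ : NumberField M) (_ : Algebra F M), Module.finrank F M = 2 ∧ (ρ.restrictField M).toGaloisRep.IsIrreducible ∧ (∃ g : GL (Fin 3) ℂ, ∀ (σ : Field.absoluteGaloisGroup M) (i : Fin 3), ∃! j : Fin 3, ((Literature.NumberTheory.GaloisRepresentations.FramedRep.conj g (ρ.restrictField M) σ : GL (Fin 3) ℂ) : Matrix (Fin 3) (Fin 3) ℂ) i j ≠ 0) ∧ ∀ᶠ v : IsDedekindDomain.HeightOneSpectrum (NumberField.RingOfIntegers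 F) in Filter.cofinite, ∀ β : Multiset ℂ, ρ.HasFrobCharpolyAt v (Literature.NumberTheory.Automorphic.satakePolynomial β) → (β.map (· ^ 2)).toFinset.card ≠ 2 → ∃ w : IsDedekindDomain.HeightOneSpectrum (NumberField.RingOfIntegers M), w.asIdeal.under (NumberField.RingOfIntegers F) = v.asIdeal ∧ w.asIdeal.inertiaDeg (NumberField.RingOfIntegers F) = 1 := by
  sorry

/-- STUB 2 (X₂ = `MonomialStrongArtin3`): strong Artin (a.e. Satake form, Artin infinity type) for
irreducible monomial three-dimensional Artin representations over any number field
(JPSS 1981 non-normal cubic + Arthur–Clozel III.6 cyclic cubic automorphic induction); size XL. -/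
theorem stub_monomialStrongArtin3 :
    ∀ (M : Type) [Field M] [NumberField M] (ρ : Literature.NumberTheory.GaloisRepresentations.FramedGaloisRep M ℂ 3), ρ.toGaloisRep.IsIrreducible → (∃ g : GL (Fin 3) ℂ, ∀ (σ : Field.absoluteGaloisGroup M) (i : Fin 3), ∃! j : Fin 3, ((Literature.NumberTheory.GaloisRepresentations.FramedRep.conj g ρ σ : GL (Fin 3) ℂ) : Matrix (Fin 3) (Fin 3) ℂ) i j ≠ 0) → ∃ (hcpt : Literature.NumberTheory.Automorphic.isCompact_glFiniteIntegralLevel 3 M) (P : Literature.NumberTheory.Automorphic.CuspidalAutomorphicRepData 3 M hcpt), P.1.HasInfinityType (fun _ => Multiset.replicate 3 ({ a := 0, b := 0, exists_int_sub := ⟨0, (sub_zero (0 : ℂ)).trans Int.cast_zero.symm⟩ } : Literature.NumberTheory.Automorphic.ArchWeight)) ∧ ∀ᶠ w : IsDedekindDomain.HeightOneSpectrum (NumberField.RingOfIntegers M) in Filter.cofinite, ∃ γ : Multiset ℂ, P.1.HasSatakeParamAt w γ ∧ ρ.IsUnramifiedAt w ∧ ρ.HasFrobCharpolyAt w (Literature.NumberTheory.Automorphic.satakePolynomial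 γ) := by
  sorry

/-- STUB 3 (X₃ = `PinnedQuadraticDescent3`): Arthur–Clozel III.4.2 (d) quadratic descent of the
a.e. matching from `M` to `F`, fibre pinned by the determinant (`n = 3` odd, CFT), with the
split/inert Satake pattern; size XL. -/
theorem stub_pinnedQuadraticDescent3 :
    ∀ (F : Type) [Field F] [NumberField F] (M : Type) [Field M] [NumberField M] [Algebra F M], Module.finrank F M = 2 → ∀ (ρ : Literature.NumberTheory.GaloisRepresentations.FramedGaloisRep F ℂ 3) (hcptM : Literature.NumberTheory.Automorphic.isCompact_glFiniteIntegralLevel 3 M) (PM : Literature.NumberTheory.Automorphic.CuspidalAutomorphicRepData 3 M hcptM), PM.1.HasInfinityType (fun _ => Multiset.replicate 3 ({ a := 0, b := 0, exists_int_sub := ⟨0, (sub_zero (0 : ℂ)).trans Int.cast_zero.symm⟩ } : Literature.NumberTheory.Automorphic.ArchWeight)) → (∀ᶠ w : IsDedekindDomain.HeightOneSpectrum (NumberField.RingOfIntegers M) in Filter.cofinite, ∃ γ : Multiset ℂ, PM.1.HasSatakeParamAt w γ ∧ (ρ.restrictField M).IsUnramifiedAt w ∧ (ρ.restrictField M).HasFrobCharpolyAt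 w (Literature.NumberTheory.Automorphic.satakePolynomial γ)) → ∃ (hcpt : Literature.NumberTheory.Automorphic.isCompact_glFiniteIntegralLevel 3 F) (P : Literature.NumberTheory.Automorphic.CuspidalAutomorphicRepData 3 F hcpt), P.1.HasInfinityType (fun _ => Multiset.replicate 3 ({ a := 0, b := 0, exists_int_sub := ⟨0, (sub_zero (0 : ℂ)).trans Int.cast_zero.symm⟩ } : Literature.NumberTheory.Automorphic.ArchWeight)) ∧ ∀ᶠ v : IsDedekindDomain.HeightOneSpectrum (NumberField.RingOfIntegers F) in Filter.cofinite, ∃ α β : Multiset ℂ, P.1.HasSatakeParamAt v α ∧ ρ.IsUnramifiedAt v ∧ ρ.HasFrobCharpolyAt v (Literature.NumberTheory.Automorphic.satakePolynomial β) ∧ (∀ x ∈ β, ‖x‖ = 1) ∧ (∀ a ∈ α, ‖a‖ = 1) ∧ α.map (· ^ 2) = β.map (· ^ 2) ∧ α.prod = β.prod ∧ ((∃ w : IsDedekindDomain.HeightOneSpectrum (NumberField.RingOfIntegers M), w.asIdeal.under (NumberField.RingOfIntegers F) = v.asIdeal ∧ w.asIdeal.inertiaDeg (NumberField.RingOfIntegers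 F) = 1) → α = β) := by
  sorry

/-! ## The composition -/

/-- COMPOSITION: the crux `CanonicalDescent36` (route decl, by name) from the three registered stubs,
through the sorry-free `canonicalDescent36_of_statements`. -/
theorem CanonicalDescent36_of :
    Summit.Langlands.Langlands.Theses.DisagreementBeurling.CanonicalDescent36 :=
  canonicalDescent36_of_statements stub_hessianQuadraticLayer stub_monomialStrongArtin3
    stub_pinnedQuadraticDescent3

end Summit.Langlands.Langlands.Cruxes.CanonicalDescent36.LayerInductionDescent
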